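import Summits.ABC.IUTFork.Repair.RHSlotReachGlue
import Summits.ABC.IUTFork.Repair.RHPlaceCutGlue
import HarnessLib

/-!
# D-0079 RESCUE sub-cell R-H, ROUND 1 row 15 «slotreach» — the k2 glue AT THE WINDOW BED: `SlotReachWindow` ⟹ the per-packet
# inclusion `qRegion ⊆ ⁿ˒°𝒰_{j,v_ℚ}` at EVERY label, and the CONSTANT-ρ hull clause of the certificate `abc_of_SH_v10K_window` (hSHw shape)

PROOF-ONLY file (D-0012: 0 definitions, 0 `Prop` facts; abc-iut cell, rung LADDER-ABC:A2.RP → A2.RESCUE-H). AUTHOR OF RECORD of the two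
statements and proofs below: abc-iut-lens-wuc-1 (`staging/RH/lens-wuc-1/K2GLUE-slotreach.lean` sha16 0f27fdbea0fb0b89, §§ «per-packet» and
«certificate shape», VERBATIM up to the namespace and the one extra argument `htq1` of the mover lemma); filed by the row's k2 desk hand
abc-iut-rp-d3 gen 5 as the proof-only companion of `Repair/RHSlotReachGlue.lean` (p462301: the mover lemma `multiReach_of_slotReachWindow`
proved) and of abc-iut-rh-typ-12's `Repair/RHSlotReach.lean` (p457641: the candidate BY NAME). TAKES NO SIDE on [IUTchIII] Cor. 3.12 or on
any author; `SlotReachWindow` is an R-H CANDIDATE = a HYPOTHESIS SHAPE, never asserted; typed ≠ proved; instantiated ≠ endorsed. Inputs BY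
NAME: `RHSlotReachGlue.multiReach_of_slotReachWindow`, abc-iut-w5-d107 `qRegion_subset_thetaHull_settingDHVolSharp_of_multiReach`, abc-iut-w5-d236
`qRegion_subset_thetaHull_settingDHVolSharp_of_movers` / `exists_mover_of_norm_le`, `qRegion_subset_thetaHull_settingDHVolSharp_inl`.

* `qRegion_subset_thetaHull_settingPrVolSharp_of_slotReachWindow` — H⋆ + dictionary + integral `t_q` ⟹ `qRegion j v_ℚ ⊆ thetaHull j v_ℚ` at
  EVERY `(j, v_ℚ)` of `settingPrVolSharp` (labels of `𝔽_l^⋇`: multi-slot movers; label `0`: identity movers; archimedean: whole packet);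
* `pilotKummerCompatHull_ofShells_settingPrVolSharp_of_slotReachWindow` — hence `PilotKummerCompatHull (LatticeSituation.ofShells …)
  (settingPrVolSharp …) (fun _ => qRegion) qK` for ANY column binders and ANY `qK`: LITERALLY the shape of the binder `hSHw` of
  `Conditional.abc_of_SH_v10K_window` (p447945) at `X := pilotDataOfK T.D T.K` — START-HERE A2's door (a) (MOVERS), not the contentless
  constant-ρ sandwich.
HONEST SCOPE as in the companions: OUR typed (Ind2) (Dupuy–Hilado, STRONGER-THAN-PRINT), SHARP boxes, hull-level reading of Step (xi-f);
«the hull clause follows from H⋆ AS TYPED», nothing more. [cite: DupuyHilado2025, §3.9, §4.9] [cite: WeilBNT1967, Ch. II §2, Th. 1]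
[cite: Mochizuki2012, IUTchIII Cor. 3.12 Step (xi-f) p. 184] [claim: Mochizuki2012, status: disputed]
-/

noncomputable section

open Set Function
open scoped Pointwise

namespace Summit.ABC.IUTFork.Repair.RHSlotReachGlue

open Thm311 Thm311.Real Cor312 Cor312.Setting Cor312Vol Literature.IUT.LogThetaLattice Literature.IUT.LogVolume
open Literature.NumberTheory.NumberFields NumberField IsDedekindDomain RHSlotReach

section Setting

variable {F : Type} [Field F] [NumberField F] (X : PilotData F) {logv : PadicLogs F} (hlog : LogvAnalytic logv)
  (M : Type) [Field M] [NumberField M]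
  (archPk : ∀ (j : (thetaIndex X).Label) (vQ : (thetaIndex X).VQ), Set ((logShellsDH X logv).Packet j vQ))
  (archSub : ∀ (j : (thetaIndex X).Label) (v : (thetaIndex X).V),
    Set ((logShellsDH X logv).Packet j ((thetaIndex X).over v)))
  (Ψ : ℤ → ∀ v : (thetaIndex X).V, v ∈ (thetaIndex X).Vbad → Set ((logShellsDH X logv).StarPacket v))
  (act : ℤ → ∀ v : (thetaIndex X).V, v ∈ (thetaIndex X).Vbad →
    (logShellsDH X logv).StarPacket v → Module.End ℚ ((logShellsDH X logv).StarPacket v))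
  (Mmod : ℤ → ∀ j : (thetaIndex X).LabelStar, Set ((logShellsDH X logv).GlobalPacket j.1))
  (region : ℤ → ∀ j : (thetaIndex X).LabelStar, FinDivisor M → ∀ vQ : (thetaIndex X).VQ,
    Set ((logShellsDH X logv).Packet j.1 vQ))
  (n : ℤ) {HT : Type} {LogLink : HT → HT → Type} {IsFull : ∀ {s t : HT}, LogLink s t → Prop}
  (lat : LGPGaussianLogThetaLattice LogLink IsFull)
  {Frd : Type} {IsoF : Frd → Frd → Type} {Ob : Frd → Type} {realify : Frd → Frd} {Strip : Type}
  {IsoS : Strip → Strip → Type} {Mv : ∀ v : (thetaIndex X).V, v ∈ (thetaIndex X).Vbad → Type}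
  [∀ v h, Monoid (Mv v h)]
  (sig : GlobalLGPFrobenioidSignature (thetaIndex X).lstar (thetaIndex X).V (· ∈ (thetaIndex X).Vbad)
    Frd IsoF Ob realify Strip IsoS Mv)
  (split : SplittingMonoids Mv) {ObΔ : Type} {N : ∀ v : (thetaIndex X).V, v ∈ (thetaIndex X).Vbad → Type}
  [∀ v h, Monoid (N v h)] (qData : QPilotData ObΔ N)
  (tq : ∀ (pp : Nat.Primes) (x : (thetaIndex X).Fibre (.inr pp)), haveI : Fact (pp : ℕ).Prime := ⟨pp.2⟩; kOf X pp.1 x)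
  (t : ∀ (pp : Nat.Primes) (_ : Fin X.lstar) (x : (thetaIndex X).Fibre (.inr pp)),
    haveI : Fact (pp : ℕ).Prime := ⟨pp.2⟩; kOf X pp.1 x)
  (htq0 : ∀ pp x, tq pp x ≠ 0)
  (htq1 : ∀ (pp : Nat.Primes) (x : (thetaIndex X).Fibre (.inr pp)),
    haveI : Fact (pp : ℕ).Prime := ⟨pp.2⟩; placeOf X pp.1 x ∉ X.S → ‖tq pp x‖ = 1)
  (col : ℤ → Column (logShellsDH X logv))
  -- the numeric dictionary of H⋆: per place `x | p` a uniformizer norm, the inner conductor and the outer radius of `log_p(𝒪_x^×)`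
  (e n₀ : ∀ pp : Nat.Primes, (thetaIndex X).Fibre (.inr pp) → ℕ)
  (lam : ∀ pp : Nat.Primes, (thetaIndex X).Fibre (.inr pp) → ℝ)
  (ϖ : ∀ (pp : Nat.Primes) (x : (thetaIndex X).Fibre (.inr pp)), haveI : Fact (pp : ℕ).Prime := ⟨pp.2⟩; kOf X pp.1 x)
  (mΘ : ∀ pp : Nat.Primes, Fin (thetaIndex X).lstar → (thetaIndex X).Fibre (.inr pp) → ℤ)
  (mq : ∀ pp : Nat.Primes, (thetaIndex X).Fibre (.inr pp) → ℤ)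

/-- **k2 (per packet): H⋆ ⟹ the hull inclusion `qRegion ⊆ ⁿ˒°𝒰` at EVERY `(j, v_ℚ)` of `settingPrVolSharp`** (any columns;
integral `t_q` for the label `0`): `multiReach_of_slotReachWindow` + abc-iut-w5-d107 `qRegion_subset_thetaHull_settingDHVolSharp_of_multiReach`
at the labels of `𝔽_l^⋇`, abc-iut-w5-d236's identity movers at the label `0` (`exists_mover_of_norm_le`), archimedean packets by
`qRegion_subset_thetaHull_settingDHVolSharp_inl`. [claim: Mochizuki2012, status: disputed] -/
theorem qRegion_subset_thetaHull_settingPrVolSharp_of_slotReachWindow (htqle : ∀ pp x, ‖tq pp x‖ ≤ 1)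
    (he : ∀ pp x, 1 ≤ e pp x)
    (hϖ : ∀ (pp : Nat.Primes) (x : (thetaIndex X).Fibre (.inr pp)), haveI : Fact (pp : ℕ).Prime := ⟨pp.2⟩
      ‖ϖ pp x‖ = (pp : ℝ) ^ (-(1 : ℝ) / (e pp x : ℝ)))
    (hsharp : ∀ (pp : Nat.Primes) (x : (thetaIndex X).Fibre (.inr pp)), haveI : Fact (pp : ℕ).Prime := ⟨pp.2⟩
      ∃ u : kOf X pp.1 x, ‖u‖ ≤ ‖ϖ pp x‖ ^ ((n₀ pp x : ℤ) - 1) ∧ u ∉ (logUnits (kOf X pp.1 x) : Set (kOf X pp.1 x)))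
    (hrad : ∀ (pp : Nat.Primes) (x : (thetaIndex X).Fibre (.inr pp)), haveI : Fact (pp : ℕ).Prime := ⟨pp.2⟩
      ∃ z ∈ (logUnits (kOf X pp.1 x) : Set (kOf X pp.1 x)), (pp : ℝ) ^ (lam pp x) ≤ ‖z‖)
    (ht1 : ∀ (pp : Nat.Primes) (i : Fin X.lstar) (x : (thetaIndex X).Fibre (.inr pp)),
      haveI : Fact (pp : ℕ).Prime := ⟨pp.2⟩; placeOf X pp.1 x ∉ X.S → ‖t pp i x‖ = 1)
    (hΘ : ∀ (pp : Nat.Primes) (i : Fin X.lstar) (w : (thetaIndex X).Fibre (.inr pp)), haveI : Fact (pp : ℕ).Prime := ⟨pp.2⟩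
      placeOf X pp.1 w ∈ X.S → ‖t pp i w‖ = ‖ϖ pp w‖ ^ (mΘ pp i w))
    (hq : ∀ (pp : Nat.Primes) (w : (thetaIndex X).Fibre (.inr pp)), haveI : Fact (pp : ℕ).Prime := ⟨pp.2⟩
      placeOf X pp.1 w ∈ X.S → ‖tq pp w‖ = ‖ϖ pp w‖ ^ (mq pp w))
    (hH : SlotReachWindow (thetaIndex X).lstar (fun pp => (thetaIndex X).Fibre (.inr pp))
      (fun pp w => haveI : Fact (pp : ℕ).Prime := ⟨pp.2⟩; placeOf X pp.1 w ∈ X.S) e n₀ lam mΘ mq)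
    (j : (thetaIndex X).Label) (vQ : (thetaIndex X).VQ) :
    (settingPrVolSharp X hlog M archPk archSub Ψ act Mmod region n lat sig split qData tq t htq0 htq1).qRegion j vQ ⊆
      (settingPrVolSharp X hlog M archPk archSub Ψ act Mmod region n lat sig split qData tq t htq0 htq1).thetaHull j vQ := by
  haveI hne : ∀ pp : Nat.Primes, Fact (pp : ℕ).Prime := fun pp => ⟨pp.2⟩
  by_cases hj : 0 < (j : ℕ)
  · -- a label of `𝔽_l^⋇`: multi-reach at every packet over every prime
    have hj' : j = labelSucc ⟨(j : ℕ) - 1, by have := j.2; simp only [thetaIndex] at this ⊢; omega⟩ := by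
      ext; simp only [labelSucc, Fin.val_succ]; omega
    rw [hj']
    cases vQ with
    | inl u =>
      exact qRegion_subset_thetaHull_settingDHVolSharp_inl X hlog M archPk archSub Ψ act Mmod region n lat sig split qData tq t htq0
        htq1 (labelSucc _) u
    | inr pp =>
      exact qRegion_subset_thetaHull_settingDHVolSharp_of_multiReach X hlog M archPk archSub Ψ act Mmod region n lat sig split qData
        tq t htq0 htq1 pp _ (multiReach_of_slotReachWindow X hlog tq t e n₀ lam ϖ mΘ mq htq1 he hϖ hsharp hrad ht1 hΘ hq hH pp _)
  · -- the label `0`: the Θ-idele is `1`, trivial movers for integral `t_q`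
    refine qRegion_subset_thetaHull_settingDHVolSharp_of_movers X hlog M archPk archSub Ψ act Mmod region n lat sig split qData tq t
      htq0 htq1 j vQ fun pp x => exists_mover_of_norm_le X hlog tq t pp j x ?_
    unfold labelIdele
    rw [dif_neg hj, norm_one]
    exact htqle pp x


/-- **k2 (certificate shape): H⋆ ⟹ the CONSTANT-ρ hull clause `PilotKummerCompatHull (LatticeSituation.ofShells …) (settingPrVolSharp …)
(fun _ => qRegion) qK`** — literally the shape of the binder `hSHw` of `Conditional.abc_of_SH_v10K_window` (any column binders, any `qK`),
cf. abc-iut-rp-j2's one-factor door `RHPlaceCutGlue.pilotKummerCompatHull_settingPrVolSharp_of_movers_labelSucc` (p455810 §2).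
[claim: Mochizuki2012, status: disputed] -/
theorem pilotKummerCompatHull_ofShells_settingPrVolSharp_of_slotReachWindow
    (frobAdm : ℤ → ℤ → ∀ (j : (thetaIndex X).Label) (vQ : (thetaIndex X).VQ), Set ((logShellsDH X logv).Packet j vQ) → Prop)
    (frobLogvol : ℤ → ℤ → ∀ (j : (thetaIndex X).Label) (vQ : (thetaIndex X).VQ), Set ((logShellsDH X logv).Packet j vQ) → ℝ)
    (frobΨ : ℤ → ℤ → ∀ v : (thetaIndex X).V, v ∈ (thetaIndex X).Vbad → Set ((logShellsDH X logv).StarPacket v))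
    (frobMmod : ℤ → ℤ → ∀ j : (thetaIndex X).LabelStar, Set ((logShellsDH X logv).GlobalPacket j.1))
    (unitImage : ℤ → ℤ → ℕ → ∀ (j : (thetaIndex X).Label) (vQ : (thetaIndex X).VQ), Set ((logShellsDH X logv).Packet j vQ))
    (ballImage : ℤ → ℤ → ∀ (j : (thetaIndex X).Label) (vQ : (thetaIndex X).VQ), Set ((logShellsDH X logv).Packet j vQ))
    (thetaDiv : ℤ → ℤ → LgpDivisor M (thetaIndex X).lstar)
    (qK : ∀ v : (thetaIndex X).V, v ∈ (thetaIndex X).Vbad → Set ((logShellsDH X logv).StarPacket v))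
    (htqle : ∀ pp x, ‖tq pp x‖ ≤ 1)
    (he : ∀ pp x, 1 ≤ e pp x)
    (hϖ : ∀ (pp : Nat.Primes) (x : (thetaIndex X).Fibre (.inr pp)), haveI : Fact (pp : ℕ).Prime := ⟨pp.2⟩
      ‖ϖ pp x‖ = (pp : ℝ) ^ (-(1 : ℝ) / (e pp x : ℝ)))
    (hsharp : ∀ (pp : Nat.Primes) (x : (thetaIndex X).Fibre (.inr pp)), haveI : Fact (pp : ℕ).Prime := ⟨pp.2⟩
      ∃ u : kOf X pp.1 x, ‖u‖ ≤ ‖ϖ pp x‖ ^ ((n₀ pp x : ℤ) - 1) ∧ u ∉ (logUnits (kOf X pp.1 x) : Set (kOf X pp.1 x)))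
    (hrad : ∀ (pp : Nat.Primes) (x : (thetaIndex X).Fibre (.inr pp)), haveI : Fact (pp : ℕ).Prime := ⟨pp.2⟩
      ∃ z ∈ (logUnits (kOf X pp.1 x) : Set (kOf X pp.1 x)), (pp : ℝ) ^ (lam pp x) ≤ ‖z‖)
    (ht1 : ∀ (pp : Nat.Primes) (i : Fin X.lstar) (x : (thetaIndex X).Fibre (.inr pp)),
      haveI : Fact (pp : ℕ).Prime := ⟨pp.2⟩; placeOf X pp.1 x ∉ X.S → ‖t pp i x‖ = 1)
    (hΘ : ∀ (pp : Nat.Primes) (i : Fin X.lstar) (w : (thetaIndex X).Fibre (.inr pp)), haveI : Fact (pp : ℕ).Prime := ⟨pp.2⟩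
      placeOf X pp.1 w ∈ X.S → ‖t pp i w‖ = ‖ϖ pp w‖ ^ (mΘ pp i w))
    (hq : ∀ (pp : Nat.Primes) (w : (thetaIndex X).Fibre (.inr pp)), haveI : Fact (pp : ℕ).Prime := ⟨pp.2⟩
      placeOf X pp.1 w ∈ X.S → ‖tq pp w‖ = ‖ϖ pp w‖ ^ (mq pp w))
    (hH : SlotReachWindow (thetaIndex X).lstar (fun pp => (thetaIndex X).Fibre (.inr pp))
      (fun pp w => haveI : Fact (pp : ℕ).Prime := ⟨pp.2⟩; placeOf X pp.1 w ∈ X.S) e n₀ lam mΘ mq) :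
    PilotKummerCompatHull
      (LatticeSituation.ofShells (logShellsDH X logv) M archPk archSub (summandPiecesPr X hlog).Adm (summandPiecesPr X hlog).logvol
        Ψ act Mmod region frobAdm frobLogvol frobΨ frobMmod unitImage ballImage thetaDiv)
      (settingPrVolSharp X hlog M archPk archSub Ψ act Mmod region n lat sig split qData tq t htq0 htq1)
      (fun _ => (settingPrVolSharp X hlog M archPk archSub Ψ act Mmod region n lat sig split qData tq t htq0 htq1).qRegion) qK :=
  fun j vQ =>
    qRegion_subset_thetaHull_settingPrVolSharp_of_slotReachWindow X hlog M archPk archSub Ψ act Mmod region n lat sig split qData tq t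
      htq0 htq1 e n₀ lam ϖ mΘ mq htqle he hϖ hsharp hrad ht1 hΘ hq hH j vQ

end Setting

end Summit.ABC.IUTFork.Repair.RHSlotReachGlue

end
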